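import Literature.Analysis.OperatorTheory.Enflo2023.PivotRoom
import HarnessLib

/-!
# Enflo 2023, v2 eq. (43)–(45): the drift budget with its honest constant, and (45) under the side condition

Source under adjudication: Per H. Enflo, *On the invariant subspace problem in Hilbert spaces*, arXiv:2305.15442
(v1 2023, v2 2024), bib key `Enflo2023` — a CLAIMED proof of the invariant subspace problem on separable Hilbert
space.  This file belongs to the kernel-tight typing of the manuscript by the b2b-enflo repair cell (Formaliser 2,
Part B).  It records what FOLLOWS from the manuscript's displayed hypotheses and, where an inference does not follow
with the printed constant, the typed inference with a witness.  NOTHING here asserts that the manuscript's main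
theorem holds; no declaration concludes the invariant subspace problem for an arbitrary operator.  Value (BLOCK-2b):
theorems / refutations of typed inferences about a text — not progress on the problem.

## (A) (43) + (44) + the step targets ⇒ (45), v2 pp.18–19 (tex L601–L650)

In first order a Main-Construction step changes `X = ⟨ch [ ]⁻¹x₀, x₀⟩` (the drift of (45)),
`Y = ⟨ch [ ]⁻¹x₀, [ ]⁻¹x₀⟩` and `Z = ch ⟨[ ]⁻¹x₀, y⟩ = ch a₀`.  By (16), `(εθ) = Re⟨[ ]⁻¹x₀, x₀⟩ − ‖[ ]⁻¹x₀‖²`, so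
the change of `(εθ)` is `Re X − 2 Re Y` (the text's "`−ch⟨[ ]⁻¹x₀, x₀ − 2[ ]⁻¹x₀⟩`", tex L641).  The targets
(tex L637–L643): `Z = −β (εθ)^{1/2}` and change of `(εθ)` `= −2β(εθ)`.  In the degenerate case (38) the three are
tied by (44): `A X + B Y − Z ≈ 0`, with (43): `(εθ)^{-1/2}/100 < B < 10 (εθ)^{-1/2}` and `|A|` small.  Solving
(all quantities real; `drift_eq`): `X = −2β(εθ) + 2Z/B`, so `|X| ≤ 2β(εθ)(1 + (εθ)^{-1/2}/B) ≤ 2β(εθ)(1 + 1/b)`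
when `B ≥ b (εθ)^{-1/2}` (`abs_drift_le_of_targets`).  The PRINTED (45) "`≤ 10 β (εθ)`" is exactly the case
`b ≥ 1/4` (`eq45_of_quarter`); with (43)'s printed lower constant `b = 1/100` the same data give `|X| = 202 β(εθ)`
(`printed_eq45_constant_fails`).  HARMLESS: the p.20 endgame holds with ANY drift constant `C` in place of `10`
(part (C): rooms `√((1 + C)(εθ)_P)`), so (45) should be read "`≤ 202 β(εθ)`" (or (43) "`B > (εθ)^{-1/2}/4`").

## (B) (45) for the CONSTRAINED steps of p.20 is a step-efficiency statement (tex L654–L683)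

The text derives (45) (tex L637–L650) for the unconstrained step and then (tex L654ff) ADDS the side condition
`⟨ch [ ]⁻¹x₀, w₀₀⟩ = 0`.  For steps obeying the exact endpoint side condition `⟨x₀ − v_P, v_{k+1} − v_k⟩ = 0`
((46)/v1) and (16) at `k`, `k+1`, the drift is DETERMINED by the step geometry (`re_inner_step_eq`):
`Re⟨x₀, v_{k+1} − v_k⟩ = ((εθ)_k − (εθ)_{k+1}) − 2 Re⟨v_k − v_P, v_{k+1} − v_k⟩ − ‖v_{k+1} − v_k‖²`.
So, under the side condition, (45) at step `k` says precisely that the step is SHORT relative to the `(εθ)` it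
consumes (`abs_re_inner_step_le_of_short`); at the pivot step it reads `‖v_{P+1} − v_P‖² ≤ (C + 1)((εθ)_P − (εθ)_{P+1})`
up to sign (`re_inner_step_eq_at_pivot`).  The text's derivation of (45) from (44) does not address this; the
availability of such short constrained steps is part of the feasibility residual (STEPS B12/B32, GAP.md §F2).

## (C) The p.20 endgame with an arbitrary drift constant

`PivotRoom.hasNontrivialClosedInvariantSubspace_of_repivoting` with `10 β (εθ)_k` replaced by `C β (εθ)_k` on the
REAL part of the drift (all the room identity uses) and rooms `2 g_i + √((1 + C)(εθ)_{p i})`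
(`hasNontrivialClosedInvariantSubspace_of_repivoting_C`).  With `C = 202` this is the endgame the text's own
constants support.

No new axioms; every theorem has closure `[propext, Classical.choice, Quot.sound]`.
-/

open scoped InnerProductSpace
open Filter Topology RCLike Finset

noncomputable section

namespace Literature.Analysis.OperatorTheory.Enflo2023

namespace Eq45

open PivotRoom

/-! ### (A) The drift budget (45) from (44) and the targets: honest constant -/

/-- Solving the first-order relations of pp.18–19 (real parts; (44) taken exact and `A = 0`): from
`X − 2Y = −2β(εθ)` (target change of `(εθ)`, via (16)) and `B Y = Z` ((44)), `X = −2β(εθ) + 2Z/B`.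
[cite: Enflo2023, v2 p.19, eq. (44)–(45)] -/
theorem drift_eq {X Y Z B E β : ℝ} (hB : B ≠ 0) (h16 : X - 2 * Y = -2 * β * E) (h44 : B * Y = Z) :
    X = -2 * β * E + 2 * Z / B := by
  have hY : Y = Z / B := by field_simp; linarith
  rw [hY] at h16
  have e : 2 * Z / B = 2 * (Z / B) := by ring
  rw [e]; linarith

/-- **(45) WITH ITS HONEST CONSTANT.**  Targets `Z = −β(εθ)^{1/2}`, change of `(εθ)` `= −2β(εθ)`; (44) exact with
`A = 0`; (43) in the form `B ≥ b (εθ)^{-1/2}` with `b > 0`.  Then `|X| ≤ 2β(εθ)(1 + 1/b)`.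
[cite: Enflo2023, v2 p.19, eq. (43)–(45)] -/
theorem abs_drift_le_of_targets {X Y B E β b : ℝ} (hE : 0 < E) (hβ : 0 ≤ β) (hb : 0 < b)
    (hB : b / Real.sqrt E ≤ B) (h16 : X - 2 * Y = -2 * β * E) (h44 : B * Y = -β * Real.sqrt E) :
    |X| ≤ 2 * β * E * (1 + 1 / b) := by
  have hsE : 0 < Real.sqrt E := Real.sqrt_pos.mpr hE
  have hB0 : 0 < B := lt_of_lt_of_le (div_pos hb hsE) hB
  have hX := drift_eq hB0.ne' h16 h44
  -- `2β√E/B ≤ 2βE/b`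
  have h1 : 2 * (β * Real.sqrt E) / B ≤ 2 * β * E / b := by
    rw [div_le_div_iff₀ hB0 hb]
    have h2 : b * Real.sqrt E ≤ B * E := by
      have := mul_le_mul_of_nonneg_right hB hsE.le
      rw [div_mul_cancel₀ _ hsE.ne'] at this
      calc b * Real.sqrt E ≤ B * Real.sqrt E * Real.sqrt E := by nlinarith
        _ = B * E := by rw [mul_assoc, Real.mul_self_sqrt hE.le]
    nlinarith
  have hXle : X ≤ 0 := by
    rw [hX]
    have : 2 * (-β * Real.sqrt E) / B ≤ 0 :=
      div_nonpos_of_nonpos_of_nonneg (by nlinarith) hB0.le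
    nlinarith
  rw [abs_of_nonpos hXle, hX]
  have e : -(-2 * β * E + 2 * (-β * Real.sqrt E) / B) = 2 * β * E + 2 * (β * Real.sqrt E) / B := by ring
  rw [e]
  calc 2 * β * E + 2 * (β * Real.sqrt E) / B ≤ 2 * β * E + 2 * β * E / b := by linarith
    _ = 2 * β * E * (1 + 1 / b) := by ring

/-- The printed constant `10` of (45) is the case `B ≥ (εθ)^{-1/2}/4` of (43) (`2(1 + 4) = 10`).
[cite: Enflo2023, v2 p.19, eq. (45)] -/
theorem eq45_of_quarter {X Y B E β : ℝ} (hE : 0 < E) (hβ : 0 ≤ β)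
    (hB : (1 / 4) / Real.sqrt E ≤ B) (h16 : X - 2 * Y = -2 * β * E) (h44 : B * Y = -β * Real.sqrt E) :
    |X| ≤ 10 * β * E := by
  have h := abs_drift_le_of_targets hE hβ (by norm_num) hB h16 h44
  linarith

/-- **THE PRINTED CONSTANT OF (45) DOES NOT FOLLOW FROM (43) AS PRINTED.**  With (43)'s lower constant
`B = (εθ)^{-1/2}/100` (inside the printed range `(εθ)^{-1/2}/100 < B < 10(εθ)^{-1/2}` up to the endpoint), the
targets and (44) (exact, `A = 0`) force `|X| = 202 β(εθ) > 10 β(εθ)`.  Instance `(εθ) = 1`, `β = 1/100`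
(any `β > 0`, `(εθ) > 0` scale the same way). HARMLESS: part (C). [cite: Enflo2023, v2 p.19, eq. (43)–(45)] -/
theorem printed_eq45_constant_fails :
    ∃ X Y B E β : ℝ, 0 < E ∧ 0 < β ∧ (1 / 100) / Real.sqrt E ≤ B ∧ B ≤ 10 / Real.sqrt E ∧
      X - 2 * Y = -2 * β * E ∧ B * Y = -β * Real.sqrt E ∧ 10 * β * E < |X| ∧ |X| = 202 * β * E := by
  refine ⟨-(202 / 100), -1, 1 / 100, 1, 1 / 100, by norm_num, by norm_num, ?_, ?_, by norm_num, ?_, ?_, ?_⟩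
  · rw [Real.sqrt_one]; norm_num
  · rw [Real.sqrt_one]; norm_num
  · rw [Real.sqrt_one]; norm_num
  · rw [abs_of_neg (by norm_num)]; norm_num
  · rw [abs_of_neg (by norm_num)]; norm_num

/-- Robust form with the `A`-term and an additive (44)-error: if `4|A| ≤ B` then
`|X| ≤ 4|β(εθ)| + 4(|Z| + |err|)/B`. [cite: Enflo2023, v2 p.19, eq. (44)] -/
theorem abs_drift_le {X Y Z A B E β err : ℝ} (hB : 0 < B) (hA : 4 * |A| ≤ B)
    (h16 : X - 2 * Y = -2 * β * E) (h44 : A * X + B * Y - Z = err) :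
    |X| ≤ 4 * |β * E| + 4 * (|Z| + |err|) / B := by
  -- `B X + 2 A X = −2βE·B + 2(Z + err)`
  have hkey : (B + 2 * A) * X = -2 * (β * E) * B + 2 * (Z + err) := by
    have hY : B * Y = Z + err - A * X := by linarith
    have h2 : B * X - 2 * (B * Y) = -2 * β * E * B := by
      calc B * X - 2 * (B * Y) = B * (X - 2 * Y) := by ring
        _ = B * (-2 * β * E) := by rw [h16]
        _ = -2 * β * E * B := by ring
    rw [hY] at h2; linarith
  have hBA : B / 2 ≤ B + 2 * A := by
    have := neg_abs_le A; linarith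
  have hBA0 : 0 < B + 2 * A := by linarith
  have habs : (B + 2 * A) * |X| ≤ 2 * |β * E| * B + 2 * (|Z| + |err|) := by
    have e1 : (B + 2 * A) * |X| = |(B + 2 * A) * X| := by rw [abs_mul, abs_of_pos hBA0]
    rw [e1, hkey]
    have e5 : |-2 * (β * E) * B| = 2 * |β * E| * B := by
      rw [abs_mul, abs_mul, abs_neg, abs_two, abs_of_pos hB]
    have e6 : |2 * (Z + err)| = 2 * |Z + err| := by rw [abs_mul, abs_two]
    calc |-2 * (β * E) * B + 2 * (Z + err)| ≤ |-2 * (β * E) * B| + |2 * (Z + err)| := abs_add_le _ _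
      _ = 2 * |β * E| * B + 2 * |Z + err| := by rw [e5, e6]
      _ ≤ 2 * |β * E| * B + 2 * (|Z| + |err|) := by linarith [abs_add_le Z err]
  have h3 : B / 2 * |X| ≤ 2 * |β * E| * B + 2 * (|Z| + |err|) :=
    (mul_le_mul_of_nonneg_right hBA (abs_nonneg X)).trans habs
  have e2 : |X| = (2 / B) * (B / 2 * |X|) := by field_simp
  have e3 : (2 / B) * (2 * |β * E| * B + 2 * (|Z| + |err|)) = 4 * |β * E| + 4 * (|Z| + |err|) / B := by
    field_simp; ring
  rw [e2, ← e3]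
  exact mul_le_mul_of_nonneg_left h3 (by positivity)

/-! ### (B) Under the exact side condition the drift is determined by the step geometry -/

section StepGeometry

variable {H : Type*} [NormedAddCommGroup H] [InnerProductSpace ℂ H]

/-- **EXACT DRIFT IDENTITY FOR A CONSTRAINED STEP.**  (16) at the bracket points `v_k`, `v_{k+1}` and the exact
endpoint side condition `⟨x₀ − v_P, v_{k+1} − v_k⟩ = 0` give
`Re⟨x₀, v_{k+1} − v_k⟩ = ((εθ)_k − (εθ)_{k+1}) − 2 Re⟨v_k − v_P, v_{k+1} − v_k⟩ − ‖v_{k+1} − v_k‖²`.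
[cite: Enflo2023, v2 p.19 (45), p.20 (46)] -/
theorem re_inner_step_eq {x₀ vP vk vk1 : H} {Ek Ek1 : ℝ} (hk : (Ek : ℂ) = ⟪vk, x₀ - vk⟫_ℂ)
    (hk1 : (Ek1 : ℂ) = ⟪vk1, x₀ - vk1⟫_ℂ) (hc : ⟪x₀ - vP, vk1 - vk⟫_ℂ = 0) :
    re ⟪x₀, vk1 - vk⟫_ℂ = (Ek - Ek1) - 2 * re ⟪vk - vP, vk1 - vk⟫_ℂ - ‖vk1 - vk‖ ^ 2 := by
  have h1 := norm_sq_eq_re_inner_sub hk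
  have h2 := norm_sq_eq_re_inner_sub hk1
  have h3 : ‖vk1 - vk‖ ^ 2 = ‖vk1‖ ^ 2 - 2 * re ⟪vk1, vk⟫_ℂ + ‖vk‖ ^ 2 := norm_sub_sq (𝕜 := ℂ) _ _
  have h4 : re ⟪x₀, vk1 - vk⟫_ℂ = re ⟪x₀, vk1⟫_ℂ - re ⟪x₀, vk⟫_ℂ := by rw [inner_sub_right, map_sub]
  -- side condition: `Re⟨x₀, D'⟩ = Re⟨v_P, D'⟩`
  have h5 : re ⟪vP, vk1 - vk⟫_ℂ = re ⟪x₀, vk1 - vk⟫_ℂ := by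
    have : ⟪x₀, vk1 - vk⟫_ℂ - ⟪vP, vk1 - vk⟫_ℂ = 0 := by rw [← inner_sub_left]; exact hc
    have := congrArg re this
    rw [map_sub, map_zero] at this; linarith
  have h6 : re ⟪vk - vP, vk1 - vk⟫_ℂ = re ⟪vk, vk1 - vk⟫_ℂ - re ⟪vP, vk1 - vk⟫_ℂ := by
    rw [inner_sub_left, map_sub]
  have h7 : re ⟪vk, vk1 - vk⟫_ℂ = re ⟪vk1, vk⟫_ℂ - ‖vk‖ ^ 2 := by
    rw [inner_sub_right, map_sub, inner_self_eq_norm_sq, inner_re_symm]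
  rw [h6, h7, h5, h3]
  linarith

/-- At the PIVOT step (`k = P`): `Re⟨x₀, v_{P+1} − v_P⟩ = ((εθ)_P − (εθ)_{P+1}) − ‖v_{P+1} − v_P‖²`.
[cite: Enflo2023, v2 p.19 (45), p.20 (46)] -/
theorem re_inner_step_eq_at_pivot {x₀ vP vP1 : H} {EP EP1 : ℝ} (hP : (EP : ℂ) = ⟪vP, x₀ - vP⟫_ℂ)
    (hP1 : (EP1 : ℂ) = ⟪vP1, x₀ - vP1⟫_ℂ) (hc : ⟪x₀ - vP, vP1 - vP⟫_ℂ = 0) :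
    re ⟪x₀, vP1 - vP⟫_ℂ = (EP - EP1) - ‖vP1 - vP‖ ^ 2 := by
  have h := re_inner_step_eq hP hP1 hc
  rw [sub_self, inner_zero_left, map_zero, mul_zero, sub_zero] at h
  exact h

/-- **(45) UNDER THE SIDE CONDITION IS STEP-SHORTNESS.**  With the identity above, a constrained step whose length
satisfies `‖D'‖² + 2‖v_k − v_P‖‖D'‖ ≤ (C − 1)((εθ)_k − (εθ)_{k+1})` has drift
`|Re⟨x₀, D'⟩| ≤ C((εθ)_k − (εθ)_{k+1})`. [cite: Enflo2023, v2 p.19 (45), p.20 (46)] -/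
theorem abs_re_inner_step_le_of_short {x₀ vP vk vk1 : H} {Ek Ek1 C : ℝ}
    (hk : (Ek : ℂ) = ⟪vk, x₀ - vk⟫_ℂ) (hk1 : (Ek1 : ℂ) = ⟪vk1, x₀ - vk1⟫_ℂ)
    (hc : ⟪x₀ - vP, vk1 - vk⟫_ℂ = 0) (hE : Ek1 ≤ Ek)
    (hshort : ‖vk1 - vk‖ ^ 2 + 2 * ‖vk - vP‖ * ‖vk1 - vk‖ ≤ (C - 1) * (Ek - Ek1)) :
    |re ⟪x₀, vk1 - vk⟫_ℂ| ≤ C * (Ek - Ek1) := by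
  have h := re_inner_step_eq hk hk1 hc
  have hcs : |re ⟪vk - vP, vk1 - vk⟫_ℂ| ≤ ‖vk - vP‖ * ‖vk1 - vk‖ :=
    (abs_re_le_norm _).trans (norm_inner_le_norm (𝕜 := ℂ) _ _)
  rw [abs_le] at hcs ⊢
  constructor <;> nlinarith [hcs.1, hcs.2, sq_nonneg ‖vk1 - vk‖]

/-- Conversely the identity bounds the STEP by the drift: `‖D'‖² ≤ ((εθ)_k − (εθ)_{k+1}) + |Re⟨x₀, D'⟩| + 2‖v_k − v_P‖‖D'‖`;
so (45) per constrained step and the room bound are two readings of one quantity. [cite: Enflo2023, v2 p.20 (46)] -/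
theorem step_sq_le_of_drift {x₀ vP vk vk1 : H} {Ek Ek1 : ℝ}
    (hk : (Ek : ℂ) = ⟪vk, x₀ - vk⟫_ℂ) (hk1 : (Ek1 : ℂ) = ⟪vk1, x₀ - vk1⟫_ℂ)
    (hc : ⟪x₀ - vP, vk1 - vk⟫_ℂ = 0) :
    ‖vk1 - vk‖ ^ 2 ≤ (Ek - Ek1) + |re ⟪x₀, vk1 - vk⟫_ℂ| + 2 * ‖vk - vP‖ * ‖vk1 - vk‖ := by
  have h := re_inner_step_eq hk hk1 hc
  have hcs : |re ⟪vk - vP, vk1 - vk⟫_ℂ| ≤ ‖vk - vP‖ * ‖vk1 - vk‖ :=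
    (abs_re_le_norm _).trans (norm_inner_le_norm (𝕜 := ℂ) _ _)
  have a1 := neg_abs_le (re ⟪x₀, vk1 - vk⟫_ℂ)
  have a2 := (abs_le.mp hcs).1
  linarith

end StepGeometry

/-! ### (C) The p.20 endgame with an arbitrary drift constant `C` (real part of the drift) -/

section Endgame

variable {H : Type*} [NormedAddCommGroup H] [InnerProductSpace ℂ H]

/-- (45) summed from a pivot, constant `C`, real parts: `|Re⟨x₀, v_n − v_P⟩| ≤ C((εθ)_P − (εθ)_n)`.
[cite: Enflo2023, v2 p.19, (45)] -/
lemma abs_re_inner_drift_le {x₀ : H} {v : ℕ → H} {εθ : ℕ → ℝ} {β C : ℝ} (hC : 0 ≤ C)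
    (h45 : ∀ k, |re ⟪x₀, v (k + 1) - v k⟫_ℂ| ≤ C * β * εθ k)
    (hratio : ∀ k, εθ (k + 1) ≤ (1 - β) * εθ k) {P n : ℕ} (hPn : P ≤ n) :
    |re ⟪x₀, v n - v P⟫_ℂ| ≤ C * (εθ P - εθ n) := by
  induction n, hPn using Nat.le_induction with
  | base => simp
  | succ n hPn ih =>
    have hsplit : v (n + 1) - v P = (v (n + 1) - v n) + (v n - v P) := by abel
    rw [hsplit, inner_add_right, map_add]
    calc |re ⟪x₀, v (n + 1) - v n⟫_ℂ + re ⟪x₀, v n - v P⟫_ℂ|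
        ≤ |re ⟪x₀, v (n + 1) - v n⟫_ℂ| + |re ⟪x₀, v n - v P⟫_ℂ| := abs_add_le _ _
      _ ≤ C * β * εθ n + C * (εθ P - εθ n) := add_le_add (h45 n) ih
      _ ≤ C * (εθ P - εθ (n + 1)) := by nlinarith [hratio n, mul_le_mul_of_nonneg_left (hratio n) hC]

/-- Room from a constraint vector near the pivot endpoint, drift constant `C`:
`‖v_n − v_P‖ ≤ 2 g + √((1 + C)((εθ)_P − (εθ)_n))`. [cite: Enflo2023, v2 p.18 (40), p.20 (46)] -/
theorem room_le_of_near_endpoint_constraint_C {x₀ c : H} {v : ℕ → H} {εθ : ℕ → ℝ} {β g C : ℝ}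
    (hC : 0 ≤ C) (hid : ∀ m, (εθ m : ℂ) = ⟪v m, x₀ - v m⟫_ℂ)
    (h45 : ∀ k, |re ⟪x₀, v (k + 1) - v k⟫_ℂ| ≤ C * β * εθ k)
    (hratio : ∀ k, εθ (k + 1) ≤ (1 - β) * εθ k) {P n : ℕ} (hPn : P ≤ n)
    (hc : ∀ k, P ≤ k → k < n → ⟪c, v (k + 1) - v k⟫_ℂ = 0) (hc0 : c ≠ 0) (hg : 0 ≤ g)
    (hang : ‖((‖x₀ - v P‖ : ℝ) : ℂ) • c - ((‖c‖ : ℝ) : ℂ) • (x₀ - v P)‖ ≤ g * (‖c‖ * ‖x₀ - v P‖))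
    (hu : ‖x₀ - v P‖ ≤ 1) (hεn : εθ n ≤ εθ P) :
    ‖v n - v P‖ ≤ 2 * g + Real.sqrt ((1 + C) * (εθ P - εθ n)) := by
  have hroom := room_sq_identity hid P n
  have hdrift := abs_re_inner_drift_le hC h45 hratio hPn
  have h0 : ⟪c, v n - v P⟫_ℂ = 0 := inner_sub_pivot_eq_zero hPn hc
  have hkey : ‖⟪x₀ - v P, v n - v P⟫_ℂ‖ ≤ g * ‖x₀ - v P‖ * ‖v n - v P‖ := by
    have e1 : ⟪((‖x₀ - v P‖ : ℝ) : ℂ) • c - ((‖c‖ : ℝ) : ℂ) • (x₀ - v P), v n - v P⟫_ℂ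
        = -(((‖c‖ : ℝ) : ℂ) * ⟪x₀ - v P, v n - v P⟫_ℂ) := by
      rw [inner_sub_left, inner_smul_left, inner_smul_left, h0, Complex.conj_ofReal,
        Complex.conj_ofReal]; ring
    have e2 := norm_inner_le_norm (𝕜 := ℂ) (((‖x₀ - v P‖ : ℝ) : ℂ) • c - ((‖c‖ : ℝ) : ℂ) • (x₀ - v P))
      (v n - v P)
    rw [e1, norm_neg, norm_mul, Complex.norm_of_nonneg (norm_nonneg c)] at e2
    have e3 : ‖c‖ * ‖⟪x₀ - v P, v n - v P⟫_ℂ‖ ≤ ‖c‖ * (g * ‖x₀ - v P‖ * ‖v n - v P‖) := by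
      calc ‖c‖ * ‖⟪x₀ - v P, v n - v P⟫_ℂ‖
          ≤ ‖((‖x₀ - v P‖ : ℝ) : ℂ) • c - ((‖c‖ : ℝ) : ℂ) • (x₀ - v P)‖ * ‖v n - v P‖ := e2
        _ ≤ g * (‖c‖ * ‖x₀ - v P‖) * ‖v n - v P‖ := by gcongr
        _ = ‖c‖ * (g * ‖x₀ - v P‖ * ‖v n - v P‖) := by ring
    exact le_of_mul_le_mul_left e3 (norm_pos_iff.mpr hc0)
  have h1 : re ⟪v P, v n - v P⟫_ℂ = re ⟪x₀, v n - v P⟫_ℂ - re ⟪x₀ - v P, v n - v P⟫_ℂ := by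
    rw [← map_sub, ← inner_sub_left, sub_sub_cancel]
  have hX : ‖v n - v P‖ ^ 2 ≤ (1 + C) * (εθ P - εθ n) + 2 * g * ‖v n - v P‖ := by
    rw [h1] at hroom
    have a1 := (abs_le.mp hdrift).1
    have a2 := abs_re_le_norm ⟪x₀ - v P, v n - v P⟫_ℂ
    have a4 := le_abs_self (re ⟪x₀ - v P, v n - v P⟫_ℂ)
    have a5 : g * ‖x₀ - v P‖ * ‖v n - v P‖ ≤ g * ‖v n - v P‖ := by
      have := mul_le_mul_of_nonneg_left hu hg
      have hD := norm_nonneg (v n - v P)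
      nlinarith
    linarith
  exact le_two_mul_add_sqrt (by nlinarith) hg hX

/-- One epoch of the re-pivoted run, drift constant `C`: room `2 g + √((1 + C)(εθ)_P)` on `[P, Q]`.
[cite: Enflo2023, v2 p.20, (46) and after] -/
theorem epoch_room_C {x₀ c : H} {v : ℕ → H} {εθ : ℕ → ℝ} {β g C : ℝ} (hC : 0 ≤ C) (hx₀ : ‖x₀‖ = 1)
    (hid : ∀ m, (εθ m : ℂ) = ⟪v m, x₀ - v m⟫_ℂ) (hpos : ∀ n, 0 ≤ εθ n) (hanti : Antitone εθ)
    (h45 : ∀ k, |re ⟪x₀, v (k + 1) - v k⟫_ℂ| ≤ C * β * εθ k)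
    (hratio : ∀ k, εθ (k + 1) ≤ (1 - β) * εθ k) {P Q : ℕ} (hc0 : c ≠ 0) (hg : 0 ≤ g)
    (hang : ‖((‖x₀ - v P‖ : ℝ) : ℂ) • c - ((‖c‖ : ℝ) : ℂ) • (x₀ - v P)‖ ≤ g * (‖c‖ * ‖x₀ - v P‖))
    (hc : ∀ k, P ≤ k → k < Q → ⟪c, v (k + 1) - v k⟫_ℂ = 0) {n : ℕ} (hPn : P ≤ n) (hnQ : n ≤ Q) :
    ‖v n - v P‖ ≤ 2 * g + Real.sqrt ((1 + C) * εθ P) := by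
  have hu : ‖x₀ - v P‖ ≤ 1 := norm_endpoint_le_one hx₀ (hid P) (hpos P)
  have h := room_le_of_near_endpoint_constraint_C hC hid h45 hratio hPn
    (fun k hk hkn => hc k hk (lt_of_lt_of_le hkn hnQ)) hc0 hg hang hu (hanti hPn)
  have h2 : Real.sqrt ((1 + C) * (εθ P - εθ n)) ≤ Real.sqrt ((1 + C) * εθ P) :=
    Real.sqrt_le_sqrt (by nlinarith [hpos n])
  linarith

/-- **PART B's TYPE-1 ENDGAME WITH AN ARBITRARY DRIFT CONSTANT.**  As
`PivotRoom.hasNontrivialClosedInvariantSubspace_of_repivoting`, with (45) in the form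
`|Re⟨x₀, v_{k+1} − v_k⟩| ≤ C β (εθ)_k` (`C ≥ 0`; the text's constants give `C = 202`, part (A)) and the
summability of `2 g_i + √((1 + C)(εθ)_{p i})`.  The unproved input is the EXISTENCE of such a run.
[cite: Enflo2023, v2 pp.19–21, (45)–(46)] -/
theorem hasNontrivialClosedInvariantSubspace_of_repivoting_C [CompleteSpace H] (T : H →L[ℂ] H)
    (x₀ : H) (hx₀ : ‖x₀‖ = 1) (v : ℕ → H) (εθ : ℕ → ℝ) (β C : ℝ) (hC : 0 ≤ C)
    (hnorm : ∀ n, (0.3 : ℝ) ≤ ‖v n‖ ∧ ‖v n‖ ≤ 0.7)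
    (h9 : ∀ n j, ‖⟪v n, (T ^ j) (x₀ - v n)⟫_ℂ‖ ≤ εθ n)
    (hid : ∀ m, (εθ m : ℂ) = ⟪v m, x₀ - v m⟫_ℂ) (hpos : ∀ n, 0 ≤ εθ n) (hanti : Antitone εθ)
    (hlim : Tendsto εθ atTop (𝓝 0))
    (h45 : ∀ k, |re ⟪x₀, v (k + 1) - v k⟫_ℂ| ≤ C * β * εθ k)
    (hratio : ∀ k, εθ (k + 1) ≤ (1 - β) * εθ k)
    (p : ℕ → ℕ) (hp : StrictMono p) (c : ℕ → H) (g : ℕ → ℝ) (hc0 : ∀ i, c i ≠ 0)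
    (hg : ∀ i, 0 ≤ g i)
    (hang : ∀ i, ‖((‖x₀ - v (p i)‖ : ℝ) : ℂ) • c i - ((‖c i‖ : ℝ) : ℂ) • (x₀ - v (p i))‖
      ≤ g i * (‖c i‖ * ‖x₀ - v (p i)‖))
    (hc : ∀ i k, p i ≤ k → k < p (i + 1) → ⟪c i, v (k + 1) - v k⟫_ℂ = 0)
    (hsum : Summable (fun i => 2 * g i + Real.sqrt ((1 + C) * εθ (p i)))) :
    HasNontrivialClosedInvariantSubspace T :=
  hasNontrivialClosedInvariantSubspace_of_rooms T x₀ hx₀ v εθ hnorm h9 hlim p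
    (fun i => ∑' m, (2 * g (m + i) + Real.sqrt ((1 + C) * εθ (p (m + i)))))
    (fun i _ hin => room_le_tsum_of_epochs (r := fun i => 2 * g i + Real.sqrt ((1 + C) * εθ (p i))) hp
      (fun i => add_nonneg (by linarith [hg i]) (Real.sqrt_nonneg _)) hsum
      (fun i _ hin hni => epoch_room_C hC hx₀ hid hpos hanti h45 hratio (hc0 i) (hg i) (hang i) (hc i) hin hni)
      hin)
    (tendsto_sum_nat_add (fun i => 2 * g i + Real.sqrt ((1 + C) * εθ (p i))))

/-- The norm form of (45) (as in `PivotRoom`) implies the real-part form used here. [folklore] -/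
lemma abs_re_drift_of_norm_drift {x₀ : H} {v : ℕ → H} {εθ : ℕ → ℝ} {β C : ℝ}
    (h45 : ∀ k, ‖⟪x₀, v (k + 1) - v k⟫_ℂ‖ ≤ C * β * εθ k) (k : ℕ) :
    |re ⟪x₀, v (k + 1) - v k⟫_ℂ| ≤ C * β * εθ k :=
  (abs_re_le_norm _).trans (h45 k)

end Endgame

end Eq45

end Literature.Analysis.OperatorTheory.Enflo2023
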